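/-
Origin: expansion seat `planner-pub-hodgecm-pv15-0`, handover 2026-08-18T04:15:56Z (optional smoke) (`HOME/pub-hodgecm-pv15/lean/Pv15/SiegelWeilSmoke.lean`, md5 e5ddc3e0, 80 lines);
landed by the gen-5 packager in gate run 21 as `HodgeCM/PerL34/SiegelWeilSmoke.lean` (import ^import Pv[0-9]+\.→import HodgeCM.PerL34. ×1).
-/
/-
Origin: pub-hodgecm-pv15 (planner-pub-hodgecm-pv15-0), node N31d — VACUITY SMOKE TEST (A1) for the
N31d shell.  OPTIONAL / lowest priority for the packager; evidence for referee 2 / adversary audits.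

Purpose.  `SiegelWeil.N31d_statement_holds (D) (P : D.PrintInputs)` is a theorem over the posited
record `DoublingKernelData` under the PRINT record `PrintInputs`.  If `PrintInputs` were
contradictory the theorem would be vacuous.  This file exhibits a NON-DEGENERATE instance in which
every `PrintInputs` field holds and both sides of the kernel identity are nonzero: the "theta =
character" toy (U(W_i)(𝔸) := the unit circle acting on 𝒮 := ℂ by scalars, χ_V := the tautological
character, [G_U] := a point, δ(φ₁, φ̄₂) := φ₁ φ̄₂, E(Ψ)(x) := x·Ψ, Siegel–Weil constant c = 1).
Nothing here is an input of the package; it only certifies satisfiability of the hypothesis record.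
-/
import Summits.HodgeConjecture.HodgeCM.PerL34.SiegelWeil_2

/-! PORT of `HodgeCM/PerL34/SiegelWeilSmoke.lean` (HodgeCMPerL run 81) — verbatim mechanical port; provenance in the PORT header line. -/

set_option autoImplicit false

noncomputable section

open MeasureTheory Complex ComplexConjugate

namespace HodgeCM.PerL34.N31d

/-- The toy doubling-kernel datum: circle characters. -/
@[reducible] def smokeData : DoublingKernelData where
  GA := Unit
  GUq := Unit
  mGUq := inferInstance
  μ := Measure.dirac ()
  proj := id
  proj_surjective := Function.surjective_id
  UA := Circle
  HA := Circle
  ι := fun u _ => u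
  S := ℂ
  instS := inferInstance
  modS := inferInstance
  Ssq := ℂ
  instSsq := inferInstance
  modSsq := inferInstance
  ω := fun u _ => (u : ℂ) • LinearMap.id
  ωsq := fun x _ => (x : ℂ) • LinearMap.id
  δ := fun φ₁ φ₂ => φ₁ * conj φ₂
  Θ := LinearMap.id
  Θsq := LinearMap.id
  χV := fun u => (u : ℂ)
  E := fun Ψ x => (x : ℂ) * Ψ

/-- Every PRINT field of N31d holds in the toy datum (so `PrintInputs` is satisfiable). -/
theorem smokeData_printInputs : smokeData.PrintInputs where
  θ_automorphic := by intro φ u g g' _; rfl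
  θsq_automorphic := by intro Φ h g g' _; rfl
  χV_norm := fun u => Circle.norm_coe u
  X2a_delta_equivariance := by
    intro φ₁ φ₂ g h₁ h₂
    show ((h₁ : ℂ) • LinearMap.id (R := ℂ)) (φ₁ * conj φ₂)
      = (h₂ : ℂ) • ((((h₁ : ℂ) • LinearMap.id (R := ℂ)) φ₁) * conj (((h₂ : ℂ) • LinearMap.id (R := ℂ)) φ₂))
    simp only [LinearMap.smul_apply, LinearMap.id_coe, id_eq, smul_eq_mul, map_mul]
    have h2 : (h₂ : ℂ) * conj (h₂ : ℂ) = 1 := by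
      rw [mul_conj, Complex.normSq_eq_norm_sq, Circle.norm_coe]; norm_num
    linear_combination (-((h₁ : ℂ) * φ₁ * conj φ₂)) * h2
  X2b_theta_poisson := by intro φ₁ φ₂; rfl
  X1_theta_integrable := fun Φ h => Integrable.of_finite
  X1_siegelWeil := by
    refine ⟨1, one_pos, fun Φ h => ?_⟩
    show ∫ x : Unit, smokeData.θsq Φ x h ∂(Measure.dirac ()) = ((1 : ℝ) : ℂ) * ((h : ℂ) * Φ)
    rw [integral_dirac]
    show ((h : ℂ) • LinearMap.id (R := ℂ)) Φ = _
    simp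

/-- Hence N31d's conclusion is inhabited non-vacuously, with both sides nonzero at φ = 1. -/
theorem smoke_N31d : N31d_statement smokeData :=
  N31d_statement_holds smokeData smokeData_printInputs

example : smokeData.θ (1 : ℂ) () (1 : Circle) * conj (smokeData.θ (1 : ℂ) () (1 : Circle)) = 1 := by
  show ((((1 : Circle) : ℂ)) • LinearMap.id (R := ℂ)) (1 : ℂ) * conj (((((1 : Circle) : ℂ)) • LinearMap.id (R := ℂ)) (1 : ℂ)) = 1
  simp

end HodgeCM.PerL34.N31d

end
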